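import Literature.NumberTheory.EllipticCurves.ModularCurveGamma0IndexProofs
import HarnessLib

/-!
# The index of `Γ(N)` in `SL₂(ℤ)` and the order of `SL₂(ℤ/Nℤ)`

Companion of `Literature.NumberTheory.EllipticCurves.ModularCurveGamma0IndexProofs` (indices of
`Γ₀(N)` and `Γ₁(N)`), completing Diamond–Shurman's Exercise 1.2.3 for the principal congruence
subgroup. For every `N ≥ 1`:

* `relIndex_Gamma_Gamma1`: `[Γ₁(N) : Γ(N)] = N` — `Γ(N)` is the kernel of the surjection
  `Γ₁(N) → ℤ/Nℤ`, `(a b; c d) ↦ b mod N` (Diamond–Shurman §1.2 p. 14 and Ex. 1.2.3(c));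
* `index_Gamma_eq_mul`: `[SL₂(ℤ) : Γ(N)] = N · [SL₂(ℤ) : Γ₁(N)]`;
* `index_Gamma`: `[SL₂(ℤ) : Γ(N)] = N · ∏_{p^k ∥ N} p^{k−1}(p + 1) · p^{k−1}(p − 1)`
  `= N³ ∏_{p ∣ N} (1 − 1/p²)` (Diamond–Shurman §1.2 p. 13 and Ex. 1.2.3(b)), from the tree's
  `index_gamma1_eq_card` and `card_unimodular`;
* `card_specialLinearGroup_zmod`: `|SL₂(ℤ/Nℤ)| = N³ ∏_{p ∣ N} (1 − 1/p²)` in the same exact form,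
  since `Γ(N)` is the kernel of the surjective reduction `SL₂(ℤ) → SL₂(ℤ/Nℤ)`
  (`specialLinearGroup_map_surjective`) (Diamond–Shurman Ex. 1.2.3(a)–(b); Shimura §1.6).

These counts enter, e.g., Calegari–Dimitrov–Tang's unbounded denominators argument through
`[Γ(2) : Γ(N)] ≫ N³` (arXiv:2109.09040, §4.2, display before Theorem 25).

Only theorems (no definitions, no named facts). Namespace as in the companion file.

## References

* F. Diamond, J. Shurman, *A first course in modular forms*, GTM 228, Springer (2005), §1.2
  (pp. 13–14) and Exercise 1.2.3 (a)–(c), p. 21.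
* G. Shimura, *Introduction to the arithmetic theory of automorphic functions*, Princeton (1971),
  §1.6.
-/

noncomputable section

open scoped MatrixGroups

open CongruenceSubgroup Matrix Matrix.SpecialLinearGroup

namespace Literature.NumberTheory.EllipticCurves.ModularForms

variable (N : ℕ)

/-- `Γ(N) ≤ Γ₁(N)`. [folklore] -/
theorem Gamma_le_Gamma1 : Gamma N ≤ Gamma1 N := by
  intro A hA
  rw [Gamma_mem] at hA
  rw [Gamma1_mem]
  exact ⟨hA.1, hA.2.2.2, hA.2.2.1⟩

/-- **`[Γ₁(N) : Γ(N)] = N`** for `N ≥ 1`: `Γ(N)` is the kernel of the homomorphism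
`Γ₁(N) → ℤ/Nℤ`, `(a b; c d) ↦ b mod N` (a homomorphism because `a ≡ d ≡ 1 (mod N)` on `Γ₁(N)`),
which is onto (`T^b ↦ b`). [cite: DiamondShurman2005, §1.2 p. 14 and Exercise 1.2.3(c)] -/
theorem relIndex_Gamma_Gamma1 [NeZero N] : (Gamma N).relIndex (Gamma1 N) = N := by
  -- the homomorphism `b mod N`, valued in `Multiplicative (ZMod N)`
  let f : Gamma1 N →* Multiplicative (ZMod N) :=
    { toFun := fun A ↦ Multiplicative.ofAdd (((A : SL(2, ℤ)) 0 1 : ℤ) : ZMod N)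
      map_one' := by simp
      map_mul' := fun A B ↦ by
        obtain ⟨hA00, -, -⟩ := (Gamma1_mem N A).mp A.2
        obtain ⟨-, hB11, -⟩ := (Gamma1_mem N B).mp B.2
        rw [← ofAdd_add]
        congr 1
        have hmul : ((A * B : Gamma1 N) : SL(2, ℤ)) 0 1 =
            (A : SL(2, ℤ)) 0 0 * (B : SL(2, ℤ)) 0 1 + (A : SL(2, ℤ)) 0 1 * (B : SL(2, ℤ)) 1 1 := by
          simp [Matrix.mul_apply, Fin.sum_univ_two]
        rw [hmul]
        push_cast
        rw [hA00, hB11]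
        ring }
  have hker : (Gamma N).subgroupOf (Gamma1 N) = f.ker := by
    ext A
    obtain ⟨hA00, hA11, hA10⟩ := (Gamma1_mem N A).mp A.2
    rw [Subgroup.mem_subgroupOf, MonoidHom.mem_ker, Gamma_mem]
    change _ ↔ Multiplicative.ofAdd (((A : SL(2, ℤ)) 0 1 : ℤ) : ZMod N) = 1
    rw [← ofAdd_zero, Multiplicative.ofAdd.apply_eq_iff_eq]
    exact ⟨fun h ↦ h.2.1, fun h ↦ ⟨hA00, h, hA10, hA11⟩⟩
  have hsurj : Function.Surjective f := by
    intro x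
    have hT : ModularGroup.T ∈ Gamma1 N := by
      rw [Gamma1_mem]
      simp [ModularGroup.coe_T]
    refine ⟨⟨ModularGroup.T ^ (x.toAdd).val, pow_mem hT _⟩, ?_⟩
    change Multiplicative.ofAdd ((((ModularGroup.T ^ (x.toAdd).val : SL(2, ℤ))) 0 1 : ℤ) :
      ZMod N) = x
    rw [← zpow_natCast, ModularGroup.coe_T_zpow]
    simp
  rw [Subgroup.relIndex, hker, Subgroup.index_ker, MonoidHom.range_eq_top.mpr hsurj,
    Subgroup.card_top, Nat.card_eq_fintype_card, Fintype.card_multiplicative, ZMod.card]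

/-- **`[SL₂(ℤ) : Γ(N)] = N · [SL₂(ℤ) : Γ₁(N)]`** for `N ≥ 1` (tower law through `Γ₁(N)`).
[cite: DiamondShurman2005, §1.2 p. 14] -/
theorem index_Gamma_eq_mul [NeZero N] : (Gamma N).index = N * (Gamma1 N).index := by
  have h := Subgroup.relIndex_mul_index (Gamma_le_Gamma1 N)
  rw [relIndex_Gamma_Gamma1] at h
  exact h.symm

/-- **Index of the principal congruence subgroup**:
`[SL₂(ℤ) : Γ(N)] = N · ∏_{p^k ∥ N} p^{k−1}(p + 1) · p^{k−1}(p − 1) = N³ ∏_{p ∣ N} (1 − 1/p²)` for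
`N ≥ 1` (exact `ℕ` form; the second factor is `[SL₂(ℤ) : Γ₁(N)]`, the number of unimodular pairs
mod `N`, by `index_gamma1_eq_card` and `card_unimodular`).
[cite: DiamondShurman2005, §1.2 p. 13 and Exercise 1.2.3(b)] -/
theorem index_Gamma [NeZero N] :
    (Gamma N).index =
      N * N.factorization.prod fun p k ↦ p ^ (k - 1) * (p + 1) * (p ^ (k - 1) * (p - 1)) := by
  rw [index_Gamma_eq_mul, index_gamma1_eq_card, card_unimodular]

/-- **Order of `SL₂(ℤ/Nℤ)`**: `|SL₂(ℤ/Nℤ)| = N · ∏_{p^k ∥ N} p^{k−1}(p + 1) · p^{k−1}(p − 1)`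
`= N³ ∏_{p ∣ N} (1 − 1/p²)` for `N ≥ 1`: `Γ(N)` is the kernel of the reduction map
`SL₂(ℤ) → SL₂(ℤ/Nℤ)`, which is onto (`specialLinearGroup_map_surjective`), so
`|SL₂(ℤ/Nℤ)| = [SL₂(ℤ) : Γ(N)]` (`index_Gamma`).
[cite: DiamondShurman2005, Exercise 1.2.3(a)–(b)] -/
theorem card_specialLinearGroup_zmod [NeZero N] :
    Nat.card SL(2, ZMod N) =
      N * N.factorization.prod fun p k ↦ p ^ (k - 1) * (p + 1) * (p ^ (k - 1) * (p - 1)) := by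
  rw [← index_Gamma N, Gamma, Subgroup.index_ker,
    MonoidHom.range_eq_top.mpr (specialLinearGroup_map_surjective N), Subgroup.card_top]

/-- `[SL₂(ℤ) : Γ(N)] = |SL₂(ℤ/Nℤ)|` for `N ≥ 1`. [cite: DiamondShurman2005, Exercise 1.2.3(b)] -/
theorem index_Gamma_eq_card [NeZero N] : (Gamma N).index = Nat.card SL(2, ZMod N) := by
  rw [index_Gamma, card_specialLinearGroup_zmod]

end Literature.NumberTheory.EllipticCurves.ModularForms

end
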